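import Literature.NumberTheory.EllipticCurves.ReductionHomomorphismSurjectiveProofs
import Literature.NumberTheory.EllipticCurves.SingularCubic
import HarnessLib

/-!
# `E₀(K)/E₁(K)` at bad reduction: inside `k̄⁺` (cusp) or `k̄ˣ` (node); prime-to-`p` torsion

Sibling proof file (theorems only) of `ReductionHomomorphism.lean` and
`ReductionHomomorphismSurjectiveProofs.lean`.  For a Weierstrass equation `W` with coefficients in
a valuation ring `R` of `K` (`hv : v.Integers R`) whose reduction `W̃` is **singular** — a cusp
(`Δ̃ = 0`, `c̃₄ = 0`: *additive reduction*) or a node (`Δ̃ = 0`, `c̃₄ ≠ 0`: *multiplicative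
reduction*), Silverman *AEC* VII.5.1 — the reduction homomorphism `E₀(K) → Ẽ_ns(k)` of
*AEC* VII.2.1 (`WeierstrassCurve.reductionHom`) followed by base change to the algebraic closure
`k̄` of the residue field and by the structure isomorphisms `Ẽ_ns(k̄) ≅ k̄⁺`, resp. `≅ k̄ˣ` of
*AEC* III.2.5 (tree: `WeierstrassCurve.nonempty_point_addEquiv_of_cusp`,
`nonempty_point_addEquiv_units_of_node`, file `SingularCubic`) gives a homomorphism

  `r : E₀(K) → k̄⁺`, resp. `E₀(K) → k̄ˣ`, with kernel exactly `E₁(K)`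

(`exists_addMonoidHom_residueField_of_cusp`, `…_units_of_node`), surjective onto `Ẽ_ns(k) ≅ kˣ`
when `R` is henselian and `k` is algebraically closed (`…_of_node_of_isAlgClosed`).  Combined with
the absence of prime-to-`p` torsion in `E₁` (*AEC* VII.3.1(a); tree
`Literature.NumberTheory.EllipticCurves.val_le_one_of_zsmul_eq_zero` via division polynomials, in the `ℝ≥0`-valued setting of
`PointReduction.lean`) this yields the classical consequences (Silverman *ATAEC* IV.9
Remark 9.2.2): on `E₀(L)` the reduction map is injective on `n`-torsion for `|n| = 1`
(`reducePoint_injOn`, *AEC* VII.3.1(b) without the good-reduction hypothesis), and at a cusp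
`E₀(L)` has no such torsion at all (`eq_zero_of_zsmul_eq_zero_of_cusp`).  These are the inputs
"`r`, `ker r = E₁`, `E₁[ℓ] = 0`" of `TateModuleInertiaReductionProofs` (Silverman *ATAEC*,
proof of IV.10.2(a)).

## References

* J. H. Silverman, *The Arithmetic of Elliptic Curves*, 2nd ed. (2009), III.2.5, VII.2.1,
  VII.3.1, VII.5.1 (PDF pp. 167–171, 180). [SilvermanAEC2009]
* J. H. Silverman, *Advanced Topics in the Arithmetic of Elliptic Curves* (1994), IV.9
  Remark 9.2.2 (PDF p. 340). [SilvermanATAEC1994]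

## Design

No definitions, no `sorry`; `noncomputable section`, `open scoped Classical`.  The base change of
reduced points to `k̄ = AlgebraicClosure k` is Mathlib's `WeierstrassCurve.Affine.Point.map` for
`W` over `R` and the `R`-algebras `k`, `k̄` (`W⁄k` is `W.map (IsLocalRing.residue R)` by `rfl`).
-/

noncomputable section

open scoped Classical NNReal

universe u

namespace WeierstrassCurve

section Structure

variable {K : Type*} [Field K] {Γ₀ : Type*} [LinearOrderedCommGroupWithZero Γ₀]
  {v : Valuation K Γ₀} {R : Type*} [CommRing R] [IsLocalRing R] [Algebra R K]
  (W : WeierstrassCurve R)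

/-- The reduction `W ⊗ k̄` is `W` mapped along `R → k → k̄`. [folklore] -/
theorem baseChange_algebraicClosure_residueField_eq :
    W.baseChange (AlgebraicClosure (IsLocalRing.ResidueField R)) =
      (W.map (IsLocalRing.residue R)).map (algebraMap (IsLocalRing.ResidueField R)
        (AlgebraicClosure (IsLocalRing.ResidueField R))) := by
  rw [baseChange, map_map]
  congr 1

/-- **Additive reduction: `E₀(K)/E₁(K) ↪ k̄⁺`** (Silverman, *AEC* VII.2.1 with III.2.5/VII.5.1(c):
`Ẽ_ns(k̄) ≅ k̄⁺` for a cusp).  If the reduction of `W` is a cusp (`Δ̃ = 0`, `c̃₄ = 0`), there is a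
homomorphism `r : E₀(K) → k̄⁺` whose kernel is exactly `E₁(K)`.
[cite: SilvermanAEC2009, VII.2 Prop. 2.1 and III.2.5 (PDF pp. 167, 56)] -/
theorem exists_addMonoidHom_residueField_of_cusp (hv : v.Integers R)
    (hΔ : IsLocalRing.residue R W.Δ = 0) (hc₄ : IsLocalRing.residue R W.c₄ = 0) :
    ∃ r : W.nonsingularReductionSubgroup hv →+ AlgebraicClosure (IsLocalRing.ResidueField R),
      ∀ P : W.nonsingularReductionSubgroup hv,
        r P = 0 ↔ W.ReducesToZero (P : (W.baseChange K).toAffine.Point) := by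
  set kb := AlgebraicClosure (IsLocalRing.ResidueField R)
  have hΔ' : (W.baseChange kb).Δ = 0 := by
    rw [baseChange_algebraicClosure_residueField_eq, map_Δ, map_Δ, hΔ, map_zero]
  have hc₄' : (W.baseChange kb).c₄ = 0 := by
    rw [baseChange_algebraicClosure_residueField_eq, map_c₄, map_c₄, hc₄, map_zero]
  obtain ⟨e⟩ := nonempty_point_addEquiv_of_cusp (W.baseChange kb) hΔ' hc₄'
  let ι := Affine.Point.map (W' := W)
    (IsScalarTower.toAlgHom R (IsLocalRing.ResidueField R) kb)
  refine ⟨(e.toAddMonoidHom.comp ι).comp (W.reductionHom hv), fun P ↦ ?_⟩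
  rw [← reducePoint_eq_zero_iff hv P.2, ← reductionHom_apply]
  change e (ι (W.reductionHom hv P)) = 0 ↔ _
  rw [e.map_eq_zero_iff, ← ι.map_zero, (Affine.Point.map_injective (W' := W) (IsScalarTower.toAlgHom R
      (IsLocalRing.ResidueField R) (AlgebraicClosure (IsLocalRing.ResidueField R)))).eq_iff]
  exact Iff.rfl

/-- **Multiplicative reduction: `E₀(K)/E₁(K) ↪ k̄ˣ`** (Silverman, *AEC* VII.2.1 with
III.2.5/VII.5.1(b): `Ẽ_ns(k̄) ≅ k̄ˣ` for a node).  If the reduction of `W` is a node (`Δ̃ = 0`,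
`c̃₄ ≠ 0`), there is a homomorphism `r : E₀(K) → k̄ˣ` whose kernel is exactly `E₁(K)`.
[cite: SilvermanAEC2009, VII.2 Prop. 2.1 and III.2.5 (PDF pp. 167, 56)] -/
theorem exists_addMonoidHom_units_of_node (hv : v.Integers R)
    (hΔ : IsLocalRing.residue R W.Δ = 0) (hc₄ : IsLocalRing.residue R W.c₄ ≠ 0) :
    ∃ r : W.nonsingularReductionSubgroup hv →+
        Additive (AlgebraicClosure (IsLocalRing.ResidueField R))ˣ,
      ∀ P : W.nonsingularReductionSubgroup hv,
        r P = 0 ↔ W.ReducesToZero (P : (W.baseChange K).toAffine.Point) := by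
  set kb := AlgebraicClosure (IsLocalRing.ResidueField R)
  have hΔ' : (W.baseChange kb).Δ = 0 := by
    rw [baseChange_algebraicClosure_residueField_eq, map_Δ, map_Δ, hΔ, map_zero]
  have hc₄' : (W.baseChange kb).c₄ ≠ 0 := by
    rw [baseChange_algebraicClosure_residueField_eq, map_c₄, map_c₄]
    exact (_root_.map_ne_zero _).mpr hc₄
  obtain ⟨e⟩ := nonempty_point_addEquiv_units_of_node (W.baseChange kb) hΔ' hc₄'
  let ι := Affine.Point.map (W' := W)
    (IsScalarTower.toAlgHom R (IsLocalRing.ResidueField R) kb)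
  refine ⟨(e.toAddMonoidHom.comp ι).comp (W.reductionHom hv), fun P ↦ ?_⟩
  rw [← reducePoint_eq_zero_iff hv P.2, ← reductionHom_apply]
  change e (ι (W.reductionHom hv P)) = 0 ↔ _
  rw [e.map_eq_zero_iff, ← ι.map_zero, (Affine.Point.map_injective (W' := W) (IsScalarTower.toAlgHom R
      (IsLocalRing.ResidueField R) (AlgebraicClosure (IsLocalRing.ResidueField R)))).eq_iff]
  exact Iff.rfl

/-- **Multiplicative reduction over a henselian ring with algebraically closed residue field:
`E₀(K)/E₁(K) ≅ kˣ`** (Silverman, *AEC* VII.2.1 — surjectivity by Hensel — with III.2.5: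
`Ẽ_ns(k) ≅ kˣ`; the situation of the strict henselisation in *ATAEC* IV.10.2(a)).  There is a
*surjective* homomorphism `r : E₀(K) → kˣ` with kernel `E₁(K)`.
[cite: SilvermanAEC2009, VII.2 Prop. 2.1 and III.2.5 (PDF pp. 167, 56)] -/
theorem exists_addMonoidHom_units_of_node_of_isAlgClosed
    [HenselianRing R (IsLocalRing.maximalIdeal R)] [IsAlgClosed (IsLocalRing.ResidueField R)]
    (hv : v.Integers R) (hΔ : IsLocalRing.residue R W.Δ = 0)
    (hc₄ : IsLocalRing.residue R W.c₄ ≠ 0) :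
    ∃ r : W.nonsingularReductionSubgroup hv →+ Additive (IsLocalRing.ResidueField R)ˣ,
      Function.Surjective r ∧
        ∀ P : W.nonsingularReductionSubgroup hv,
          r P = 0 ↔ W.ReducesToZero (P : (W.baseChange K).toAffine.Point) := by
  have hΔ' : (W.map (IsLocalRing.residue R)).Δ = 0 := by rw [map_Δ, hΔ]
  have hc₄' : (W.map (IsLocalRing.residue R)).c₄ ≠ 0 := by rw [map_c₄]; exact hc₄
  obtain ⟨e⟩ := nonempty_point_addEquiv_units_of_node (W.map (IsLocalRing.residue R)) hΔ' hc₄'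
  refine ⟨e.toAddMonoidHom.comp (W.reductionHom hv),
    e.surjective.comp (W.reductionHom_surjective hv), fun P ↦ ?_⟩
  rw [← reducePoint_eq_zero_iff hv P.2, ← reductionHom_apply]
  exact e.map_eq_zero_iff

end Structure

/-! ### Prime-to-`p` torsion (the `ℝ≥0`-valued setting of `PointReduction.lean`) -/

section Torsion

variable {L : Type u} [Field L] {w : Valuation L ℝ≥0} (W : WeierstrassCurve w.integer)

/-- **`E₁` has no prime-to-`p` torsion** (Silverman, *AEC* VII.3.1(a); tree
`Literature.NumberTheory.EllipticCurves.val_le_one_of_zsmul_eq_zero`, by division polynomials): a point `P` with `n • P = O`,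
`|n| = 1`, which reduces to `O` is `O`. [cite: SilvermanAEC2009, VII.3 Prop. 3.1(a) (PDF p. 171)] -/
theorem ReducesToZero.eq_zero_of_zsmul_eq_zero {n : ℤ} (hn : w n = 1)
    {P : (W.baseChange L).toAffine.Point} (hP : n • P = 0) (h0 : W.ReducesToZero P) : P = 0 := by
  haveI : (W.baseChange L).IsIntegral w.integer := ⟨W, rfl⟩
  rcases (W.reducesToZero_iff_eq_zero_or_not_isIntegralPoint P).mp h0 with h | h
  · exact h
  · exact (h (Literature.NumberTheory.EllipticCurves.isIntegralPoint_of_zsmul_eq_zero hn hP)).elim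

/-- **Reduction is injective on the prime-to-`p` torsion of `E₀(L)`** (Silverman, *AEC*
VII.3.1(b), there for good reduction where `E₀ = E`; in general from VII.2.1 and VII.3.1(a)):
two points of `E₀(L)` killed by `n` with `|n| = 1` and with the same reduction are equal.
[cite: SilvermanAEC2009, VII.3 Prop. 3.1 (PDF pp. 170–171)] -/
theorem eq_of_reducePoint_eq_of_zsmul_eq_zero {n : ℤ} (hn : w n = 1)
    {P Q : (W.baseChange L).toAffine.Point} (hP : W.HasNonsingularReduction P)
    (hQ : W.HasNonsingularReduction Q) (hnP : n • P = 0) (hnQ : n • Q = 0)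
    (h : W.reducePoint P = W.reducePoint Q) : P = Q := by
  have hv := Valuation.integer.integers w
  have hPQ : W.HasNonsingularReduction (P - Q) := by
    rw [sub_eq_add_neg]; exact hP.add hv hQ.neg
  have hred : W.reducePoint (P - Q) = 0 := by
    rw [sub_eq_add_neg, reducePoint_add hv hP hQ.neg, reducePoint_neg hv.hom_inj, h, add_neg_cancel]
  have h0 : W.ReducesToZero (P - Q) := (reducePoint_eq_zero_iff hv hPQ).mp hred
  exact sub_eq_zero.mp (h0.eq_zero_of_zsmul_eq_zero W hn (by rw [zsmul_sub, hnP, hnQ, sub_zero]))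

/-- **At a cusp, `E₀(L)` has no prime-to-`p` torsion** (Silverman, *ATAEC* IV.9 Remark 9.2.2:
`E₁` has no prime-to-`p` torsion and `Ẽ_ns(k) = k⁺` is a `p`-group): if the reduction of `W`
is a cusp (`Δ̃ = 0`, `c̃₄ = 0`), `n • P = O` with `|n| = 1` and `P ∈ E₀(L)`, then `P = O`.
[cite: SilvermanATAEC1994, IV.9 Remark 9.2.2 (PDF p. 340)] -/
theorem eq_zero_of_zsmul_eq_zero_of_cusp (hΔ : IsLocalRing.residue w.integer W.Δ = 0)
    (hc₄ : IsLocalRing.residue w.integer W.c₄ = 0) {n : ℤ} (hn : w n = 1)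
    {P : (W.baseChange L).toAffine.Point} (hP : W.HasNonsingularReduction P) (hnP : n • P = 0) :
    P = 0 := by
  have hv := Valuation.integer.integers w
  obtain ⟨r, hr⟩ := W.exists_addMonoidHom_residueField_of_cusp hv hΔ hc₄
  -- `n` is non-zero in the residue field, hence in `k̄`
  have hn0 : (n : AlgebraicClosure (IsLocalRing.ResidueField w.integer)) ≠ 0 := by
    have h1 : IsLocalRing.residue w.integer (n : w.integer) ≠ 0 := by
      rw [Ne, IsLocalRing.residue_eq_zero_iff, IsLocalRing.mem_maximalIdeal, mem_nonunits_iff,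
        not_not, hv.isUnit_iff_valuation_eq_one]
      simpa using hn
    have := (_root_.map_ne_zero (algebraMap (IsLocalRing.ResidueField w.integer)
      (AlgebraicClosure (IsLocalRing.ResidueField w.integer)))).mpr h1
    simpa using this
  have hrP : r ⟨P, hP⟩ = 0 := by
    have : n • r ⟨P, hP⟩ = 0 := by
      rw [← map_zsmul]
      convert r.map_zero
      exact Subtype.ext hnP
    rw [zsmul_eq_mul] at this
    exact (mul_eq_zero.mp this).resolve_left hn0
  exact ((hr ⟨P, hP⟩).mp hrP).eq_zero_of_zsmul_eq_zero W hn hnP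

/-- **Additive reduction kills the prime-to-`p` torsion of `E₀`**, in the language of
`PointReduction.lean` (Silverman, *ATAEC* IV.9 Remark 9.2.2): for a `w`-integral equation `V`
whose reduction is a cusp (`|Δ| < 1`, `|c₄| < 1`), an integral point `P = (x, y)` (`|x| ≤ 1`) with
nonsingular reduction and `n • P = O`, `|n| = 1`, does not exist.  (The input "`E₀[ℓⁿ] = 0`" of the
additive case of Silverman *ATAEC* IV.10.2(a), at the level of a single valued field.)
[cite: SilvermanATAEC1994, IV.9 Remark 9.2.2 (PDF p. 340)] -/
theorem _root_.Literature.NumberTheory.EllipticCurves.not_zsmul_eq_zero_of_val_Δ_lt_one_of_val_c₄_lt_one {V : WeierstrassCurve L}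
    [hV : V.IsIntegral w.integer] (hΔ : w V.Δ < 1) (hc₄ : w V.c₄ < 1) {n : ℤ} (hn : w n = 1)
    {x y : L} {h : V.toAffine.Nonsingular x y} (hx : w x ≤ 1)
    (hns : (Literature.NumberTheory.EllipticCurves.reduceCurve (IsLocalRing.residue w.integer) V).toAffine.Nonsingular
      (Literature.NumberTheory.EllipticCurves.reduceFun (IsLocalRing.residue w.integer) x)
      (Literature.NumberTheory.EllipticCurves.reduceFun (IsLocalRing.residue w.integer) y))
    (hP : n • Affine.Point.some x y h = 0) : False := by
  obtain ⟨W₀, rfl⟩ := hV.integral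
  have hv := Valuation.integer.integers w
  have hy : w y ≤ 1 := Literature.NumberTheory.EllipticCurves.v_Y_le_one_of_v_X_le_one hv h.1 hx
  rw [Literature.NumberTheory.EllipticCurves.reduceCurve_baseChange, Literature.NumberTheory.EllipticCurves.reduceFun_of_le _ hx, Literature.NumberTheory.EllipticCurves.reduceFun_of_le _ hy] at hns
  have h' : (W₀.baseChange L).toAffine.Nonsingular (algebraMap w.integer L ⟨x, hx⟩)
      (algebraMap w.integer L ⟨y, hy⟩) := h
  have hE₀ : W₀.HasNonsingularReduction (Affine.Point.some _ _ h') :=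
    (hasNonsingularReduction_some_algebraMap_iff hv.hom_inj h').mpr hns
  have hΔ' : IsLocalRing.residue w.integer W₀.Δ = 0 := by
    rw [← Literature.NumberTheory.EllipticCurves.v_algebraMap_lt_one_iff hv]; rwa [baseChange, map_Δ] at hΔ
  have hc₄' : IsLocalRing.residue w.integer W₀.c₄ = 0 := by
    rw [← Literature.NumberTheory.EllipticCurves.v_algebraMap_lt_one_iff hv]; rwa [baseChange, map_c₄] at hc₄
  exact Affine.Point.some_ne_zero h'
    (W₀.eq_zero_of_zsmul_eq_zero_of_cusp hΔ' hc₄' hn hE₀ hP)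

end Torsion

end WeierstrassCurve
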